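import Summits.QuantumFields.YangMills.Theses.BalabanUVNodes
import Summits.QuantumFields.YangMills.Theorems.BalabanUVNodesN27AtAllPinsOfRecord13CoPHVCutBFreeBareLedgerReadingKernelFaces
import Summits.QuantumFields.YangMills.Theorems.BalabanUVNodesN20OffLiveOneTermReading

/-!
# ★★ LEAF AWBⱽ-1T-K (dag-n27-c g18) — THE ITEM `SpineGivenEndpointR13SepCoPHV` AT EVERY VERSION SLOT FROM ALL PINS, NODE U3 READ AT THE **LIMITING KERNELS OF RECORD**
# (the three KERNEL FACES `hK h18 h22` of APᴮ §1 ∕ (Kꜰ)ᴮ in place of the finite-volume letters `(s r) hr hinc hS h9 hWall`), N19′ AT THE BARE LEDGER READING, OFF-LIVE ONE TARGET ROW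
# = AWBⱽ-1T (`…SepCoPHVAllPinsOfRecordVBFreeBareLedgerReadingOneTerm`, p642511) over storey APBᴷ (`…N27AtAllPinsOfRecord13CoPHVCutBFreeBareLedgerReadingKernelFaces`) instead of APBᴮ.

Cell `pub-ymgap`, HUMAN RULING D-0062 Track A; R134 seat `pub-ymgap-dag-n27-c` (N27 B5 composite, s2), gen 18; K3⁸ `SpineGivenEndpointR13SepCoPHV` = stmt-QuantumFields-27366 (skeleton v6
b4e55110ab73e679), `--kind proof --supports 27366 --as helper`; COUNT-NEUTRAL.  ONE theorem, 0 `def`, 0 `sorry`; `N = 2`; guard `ZhUnity ∧ SlotsNondegenerate₁₃`; route-facing (imports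
`Theses.BalabanUVNodes`, the storey and dag-n20-w1's one-term reading); namespace `…Theorems.BalabanUVNodesN27SpineRecord`.

WHAT IS KERNEL-CHECKED ([bookkeeping]; AWBⱽ-1T's proof VERBATIM with the row swap): ★★★
`spineGivenEndpointR13SepCoPHV_of_liveV5PinsAtCrOfRecord₁₃VAt_cut_bareLedgerReadingV_kernelFaces_offLiveOneTerm_v5pins_bFree` ⊢ **`SpineGivenEndpointR13SepCoPHV` BY NAME** from: the four
pins · `h16` · `hs hκ hcr hκ₀` · the KERNEL FACES `hK` (the (D4)-type letter `KernelDecayOfRecord₁₃ … μ ν (ℓ F θ).κ` at every pair), `h18` (`∀ k, N18At (u3OfRecord₁₃ θ (objectsOfRecord₁₃ F 2 θ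
(ℓ F θ)) k)`), `h22` (`∀ k, N22At (…)`) · `hβ23 hβ1 hmatch hend hradii hclass hH3 hsel3 hβw` · live `hζm h20 h21 hlinkBareV` · off-live ONE row `htarget`.  Live ⟸ APBᴷ §1 at
`Rg := guard ∧ LiveSel`, `hsel := ⟨_, hRg.2⟩`; off-live ⟸ (Kꜰ)ᴮ `bodyBFree₁₃CoPH_of_kernels_pin_bFree` at `crOneTerm₁₃ K₀` fed `hK 0 1`, `h18`, `h22` directly; FILE 1 `bodyBFree₁₃CoPH_of_split` +
`hybridNE7Under_of_forSmallCouplings_stringwise` at the slot datum.  THE SOCKET: any producer of a kernel face in the LIMIT currency plugs here BY NAME — dag-n22-c's J-series ∕ dag-n22-w5's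
printed editions (`NE9 ((objectsOfRecord₁₃ …).EA 0) …` ⟹ `h22` by dag-n22-w3's `n22At_u3OfRecord₁₃_objectsOfRecord₁₃_iff`), N18's letter `KernelStepRateOfRecord₁₃ … (ℓ F θ).κ (ℓ F θ).θ₅
(ℓ F θ).C₅` (⟹ `h18` by `n18At_u3OfRecord₁₃_objectsOfRecord₁₃_of_kernelStepRateOfRecord₁₃`), dag-n18-w4 FILE 5's base road (⟹ `hK`); the sibling leaf `…OneTermN22SectorRoad` is the first plug.

HONEST FRAMING (binding): COMPOSITE-node bookkeeping BY NAME; a REDUCTION, not a discharge; every displayed row a HYPOTHESIS or a decided MODEL (0∕1 today; K0⁷ OPEN); the kernel faces are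
Bałaban-TYPE shapes ((5.10) ∕ NE5 ∕ NE9) NOT PRINTED as such for d = 4, read at the (1.21) limits of record whose existence is NOT asserted; `hlinkBareV` = NODE O's world (UNPRINTED content,
0 instances); N11 NOT READ; `hβw` = K1's window currency (K1⁹ OPEN); `htarget` = node U5's Target under v6's (B)-free rates antecedent, free selector `ksel`; nothing of Bałaban's or King's
asserted or instantiated; NOT `stub_rates13HV` ∕ `stub_expansion13HV`; N14–N22 ∕ N27 NOT discharged (the chair books, R417); K3⁸ OPEN, NOT claimed; counts UNMOVED (typed 28∕28 · discharged
5∕27, A 5∕28); one finite four-torus programme at fixed `ε` — NOT ℝ⁴, NOT OS, NOT a mass gap, NOT Clay.  No decl below carries a cite tag.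
-/


set_option autoImplicit false

namespace Summit.QuantumFields.YangMills.Theorems.BalabanUVNodesN27SpineRecord
open scoped BigOperators Matrix Matrix.Norms.L2Operator
open Finset MeasureTheory
open Literature.MathematicalPhysics.QuantumFieldTheory.Balaban1983to89
open T4OutputRate T4RecentScale T4GoodClassBudget T4CauchySum T4TowerRateComposition T4TowerRateDischarge
open T4EtaRateMin (Readings NE3Shape)
open T4RateLiaison (GaugeDominated)
open FlowStep (RGEqH prefixOf)
open TreeLengthTorus (TFaceConnected torusTreeLen)
open B12TreeDecay (kappa₀)
open Summit.QuantumFields.BalabanUV.T4Continuum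
open AveragingDeficitDualResidual (dualC1 dualC2)
open AveragingDeficitDerivWallProof (wallConst)
open AveragingDeficitPeriodicCounting (IsPeriodicDir)
open MinimalActionSandwich (IsMinimiser minAct)
open MinimalActionRate (sfClass)
open MinimalActionRefine (RegularSup gradConst)
open NE3EnergyShapes (IsUnitarySite IsPeriodicSite)
open NE3.LeafIndexSockets (LeafH3sup)
open Summit.QuantumFields.BalabanUV.T4Continuum.Spine
open Summit.QuantumFields.BalabanUV.T4Continuum.Spine.NE4 (runFlow)
open Summit.QuantumFields.BalabanUV.T4Continuum.NE1p.DressedRoot (DressedTower DressedStabilityStrict)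
open Summit.QuantumFields.YangMills.BalabanUVNodes.N19LedgerLinkSync (LedgerDataSync LedgerAtSync)
open YMDAG.UVSplit
open Summit.QuantumFields.YangMills.BalabanUVNodes.N16HolderDefs (CovRootHolder N16HolderAt)
open Summit.QuantumFields.YangMills.BalabanUVNodes.SpineRatesHolder (RatesHolderAt)
open Literature.MathematicalPhysics.QuantumFieldTheory.Balaban1983to89.T4Continuum (T4Family ULoop)
open Node00 (Stage13HParams datumOfRecord₁₃CoPH SiteSeqKey U3Letters₁₁ NE3Letters₁₁ ne3ConstLayerOfRecord₁₁ ne3NperOfRecord₁₁ ne3DomOfRecord₁₁ ZetaMeasurable ppSelLiveOfRecord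
  EOfRecord₁₃ wOfRecord₉ localBgMeasurable)
open Literature.MathematicalPhysics.QuantumFieldTheory.Balaban1983to89.B12Sec2to5 (betaPrime510)
open Literature.MathematicalPhysics.QuantumFieldTheory.Balaban1983to89.Node00.U3OfKernels (objectsOfRecord₁₃ KernelDecayOfRecord₁₃)
open Literature.MathematicalPhysics.QuantumFieldTheory.Balaban1983to89.Node00.U3KernelLetters (GeometricIncrementsOfRecord₁₃ WindowedNE9OfRecord₁₃ WindowedDecayOfRecord₁₃
  WindowedStepRateOfRecord₁₃)
open Summit.QuantumFields.YangMills.BalabanUVNodes.N16PinnedLayer13CoPH (N16PinnedLoose N16LettersEnd rateCarriers_ne3_of_pinnedLoose)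
open Summit.QuantumFields.YangMills.BalabanUVNodes.N19TargetClassWeightsE1Keyed
open YMDAG.N14.TopBorn (Ne1PinnedOfRecord n14At_rateCarriersOfRecord₁₃CoPH_of_pinned)
open Summit.QuantumFields.YangMills.BalabanUVNodes.N15.GenuineRecord (fullGSizedObjects n15At_fullGSizedObjects_family)
open Summit.QuantumFields.YangMills.BalabanUVNodes.N15.AtKeyedHome (neZero_blockFactor)
open T4WeightBudget T4IndicatorShell T4ContinuumYM4Torus T4ApexHybrid
open Summit.QuantumFields.YangMills.Theses.BalabanUVNodes (SpineGivenEndpointR13SepCoPHV)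
open NE7 (Target)
open Summit.QuantumFields.YangMills.BalabanUVNodes.N20OffLiveOneTermReading (crOneTerm₁₃ h20_shape_crOneTerm₁₃ h21_shape_crOneTerm₁₃ extraction_crOneTerm₁₃ core_crOneTerm₁₃_iff_target)
variable (K₀ : ℕ) (jc : (F : T4Family) → (θ : Stage13HParams F 2) → θ.Provisos₁₃CoPH F 2 → (ℕ → ℝ) → List (ULoop F) → ℕ → ℕ)
  (sh : ShellSplit₁₃CoPH 2 K₀)
  (β : ℝ) (𝔯 : RateReading₁₃CoPH 2)
  (ℓ : (F : T4Family) → Stage13HParams F 2 → U3Letters₁₁)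
  (ℓ₃ : T4Family → NE3Letters₁₁) (g B c' : T4Family → ℝ)

/-- ★★★ **THE ITEM `SpineGivenEndpointR13SepCoPHV` AT EVERY VERSION SLOT — LIVE: ALL PINS, NODE U3 AT THE LIMITING KERNELS OF RECORD (faces `hK h18 h22`), N19′ AT THE BARE LEDGER
READING; OFF-LIVE: ONE (B)-FREE TARGET ROW** (`N = 2`, guard `ZhUnity ∧ SlotsNondegenerate₁₃`, `hP := h.toCore`; live = APBᴷ §1 at `Rg := guard ∧ LiveSel` with `hsel := hRg.2`; off-live =
(Kꜰ)ᴮ `bodyBFree₁₃CoPH_of_kernels_pin_bFree` at `crOneTerm₁₃ K₀` — N20 ∕ N21 ∕ N27x FREE, N19′ ⟸ `htarget` through `core_crOneTerm₁₃_iff_target`, kernel faces passed as they are; FILE 1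
`bodyBFree₁₃CoPH_of_split` + `hybridNE7Under_of_forSmallCouplings_stringwise` at `Node00.datumOfRecord₁₃SepCoPHV F 2 θ h v`, the slot's (B) ∕ endpoint binders discarded).  NOT a discharge;
every row a HYPOTHESIS or a decided MODEL; N11 NOT READ; no node discharged; K3⁸ OPEN. [bookkeeping] -/
theorem spineGivenEndpointR13SepCoPHV_of_liveV5PinsAtCrOfRecord₁₃VAt_cut_bareLedgerReadingV_kernelFaces_offLiveOneTerm_v5pins_bFree
    (ksel : (F : T4Family) → (θ : Stage13HParams F 2) → θ.Provisos₁₃CoPH F 2 → (ℕ → ℝ) → List (ULoop F) → ℕ)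
    (hpin1 : Ne1PinnedOfRecord 𝔯)
    (hpin2 : ∃ (b aS : ℝ) (ν μ α β' : Fin 4) (c35 p : ℝ), 0 < b ∧ 0 < aS ∧
      ∀ (F : T4Family) (θ : Stage13HParams F 2) (hP : θ.Provisos₁₃CoPH F 2) (g₀ : ℕ → ℝ) (os : List (ULoop F)) (k : ℕ),
        (𝔯.lit F θ hP g₀ os).ne2 k = haveI := neZero_blockFactor F; fullGSizedObjects 3 F.hL b aS ν μ α β' c35 p)
    (hpinL : N16PinnedLoose 𝔯 ℓ₃ B)
    (hpin : ∀ (F : T4Family) (θ : Stage13HParams F 2) (hP : θ.Provisos₁₃CoPH F 2) (g₀ : ℕ → ℝ) (os : List (ULoop F)),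
      (𝔯.lit F θ hP g₀ os).u3 = objectsOfRecord₁₃ F 2 θ.toStage13Params (ℓ F θ))
    (h16 : ∀ (F : T4Family), (∃ θ : Stage13HParams F 2, θ.Provisos₁₃CoPH F 2 ∧ (θ.ZhUnity F 2 ∧ θ.SlotsNondegenerate₁₃ F 2) ∧ θ.Admissible F 2) →
      N16HolderAt (ne3OfRecord₁₁ F { ne3ConstLayerOfRecord₁₁ F 2 (ℓ₃ F) with
        dom := {V | V ∈ ne3DomOfRecord₁₁ F 2 0 0 ∧ V ∈ sfClass 4 F.L (ne3NperOfRecord₁₁ F 0 0) ((ℓ₃ F).ε / B F) 0} }) β)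
    (hs : ∀ (F : T4Family) (θ : Stage13HParams F 2), θ.Provisos₁₃CoPH F 2 → (θ.ZhUnity F 2 ∧ θ.SlotsNondegenerate₁₃ F 2) → θ.Admissible F 2 → (ℓ F θ).Signs)
    (hκ : ∀ (F : T4Family) (θ : Stage13HParams F 2), θ.Provisos₁₃CoPH F 2 → (θ.ZhUnity F 2 ∧ θ.SlotsNondegenerate₁₃ F 2) → θ.Admissible F 2 → 0 < (ℓ F θ).κ)
    (hcr : ∀ (F : T4Family) (θ : Stage13HParams F 2), θ.Provisos₁₃CoPH F 2 → (θ.ZhUnity F 2 ∧ θ.SlotsNondegenerate₁₃ F 2) → θ.Admissible F 2 →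
      betaPrime510 4 1 (ℓ F θ).κ ≤ (ℓ F θ).cr)
    (hκ₀ : ∀ (F : T4Family) (θ : Stage13HParams F 2), θ.Provisos₁₃CoPH F 2 → (θ.ZhUnity F 2 ∧ θ.SlotsNondegenerate₁₃ F 2) → θ.Admissible F 2 → kappa₀ (4 * 2 ^ 4) (2 * 4) ≤ (ℓ F θ).κ)
    (hK : ∀ (μ ν : Fin 4) (F : T4Family) (θ : Stage13HParams F 2), θ.Provisos₁₃CoPH F 2 → (θ.ZhUnity F 2 ∧ θ.SlotsNondegenerate₁₃ F 2) → θ.Admissible F 2 →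
      KernelDecayOfRecord₁₃ F 2 θ.toStage13Params μ ν (ℓ F θ).κ)
    (h18 : ∀ (F : T4Family) (θ : Stage13HParams F 2), θ.Provisos₁₃CoPH F 2 → (θ.ZhUnity F 2 ∧ θ.SlotsNondegenerate₁₃ F 2) → θ.Admissible F 2 →
      ∀ k : ℕ, N18At (u3OfRecord₁₃ θ.toStage13Params (objectsOfRecord₁₃ F 2 θ.toStage13Params (ℓ F θ)) k))
    (h22 : ∀ (F : T4Family) (θ : Stage13HParams F 2), θ.Provisos₁₃CoPH F 2 → (θ.ZhUnity F 2 ∧ θ.SlotsNondegenerate₁₃ F 2) → θ.Admissible F 2 →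
      ∀ k : ℕ, N22At (u3OfRecord₁₃ θ.toStage13Params (objectsOfRecord₁₃ F 2 θ.toStage13Params (ℓ F θ)) k))
    (hβ23 : 2 / 3 < β) (hβ1 : β ≤ 1)
    (hmatch : ∀ F : T4Family, 0 < B F ∧ (ℓ₃ F).ε / B F ≤ (ℓ₃ F).b)
    (hend : N16LettersEnd 2 g ℓ₃)
    (hradii : ∀ F : T4Family, (ℓ₃ F).g = gradConst 4 (c' F) ∧ 0 ≤ c' F ∧ 0 < c' F ∧ (ℓ₃ F).b ≤ c' F ∧
      (2 : ℝ) ^ 91 * (F.L : ℝ) ^ 17 * c' F ≤ 1 ∧ (2 : ℝ) ^ 76 * (F.L : ℝ) ^ 12 * c' F ≤ (ℓ₃ F).ε ∧ (ℓ₃ F).ε / B F ≤ 1 / 4 ∧ 4 * ((ℓ₃ F).ε / B F) ≤ c' F)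
    (hclass : ∀ F : T4Family, 16 * B7Prop2Explicit.C0 4 * (ℓ₃ F).ε ≤ 3 ∧ 1024 * (4 + 1) * (4 + 4) * (F.L : ℝ) ^ 2 * (ℓ₃ F).ε ≤ 1)
    (hH3 : ∀ (F : T4Family) (θ : Stage13HParams F 2) (hP : θ.Provisos₁₃CoPH F 2) (g₀ : ℕ → ℝ) (os : List (ULoop F)) (k : ℕ),
      LeafH3sup 4 (rateCarriersOfRecord₁₃CoPH 𝔯 F θ hP g₀ os k).ne3.L (rateCarriersOfRecord₁₃CoPH 𝔯 F θ hP g₀ os k).ne3.Nper (rateCarriersOfRecord₁₃CoPH 𝔯 F θ hP g₀ os k).ne3.ε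
        (rateCarriersOfRecord₁₃CoPH 𝔯 F θ hP g₀ os k).ne3.b (c' F) (rateCarriersOfRecord₁₃CoPH 𝔯 F θ hP g₀ os k).ne3.dom)
    (hsel3 : ∀ (F : T4Family) (θ : Stage13HParams F 2) (hP : θ.Provisos₁₃CoPH F 2) (g₀ : ℕ → ℝ) (os : List (ULoop F)) (k : ℕ),
      ∃ sel : ℕ → (B7Prop1Explicit.Site 4 → Fin 4 → (Matrix (Fin 2) (Fin 2) ℂ)ˣ) → (B7Prop1Explicit.Site 4 → Fin 4 → (Matrix (Fin 2) (Fin 2) ℂ)ˣ),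
        (∀ V ∈ (rateCarriersOfRecord₁₃CoPH 𝔯 F θ hP g₀ os k).ne3.dom, ∀ j : ℕ,
          IsMinimiser 4 (sfClass 4 (rateCarriersOfRecord₁₃CoPH 𝔯 F θ hP g₀ os k).ne3.L (rateCarriersOfRecord₁₃CoPH 𝔯 F θ hP g₀ os k).ne3.Nper (rateCarriersOfRecord₁₃CoPH 𝔯 F θ hP g₀ os k).ne3.ε)
            (rateCarriersOfRecord₁₃CoPH 𝔯 F θ hP g₀ os k).ne3.L (rateCarriersOfRecord₁₃CoPH 𝔯 F θ hP g₀ os k).ne3.Nper j V (sel j V)) ∧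
        (∀ V ∈ (rateCarriersOfRecord₁₃CoPH 𝔯 F θ hP g₀ os k).ne3.dom, ∀ j : ℕ,
          RegularSup 4 (rateCarriersOfRecord₁₃CoPH 𝔯 F θ hP g₀ os k).ne3.L (rateCarriersOfRecord₁₃CoPH 𝔯 F θ hP g₀ os k).ne3.Nper (rateCarriersOfRecord₁₃CoPH 𝔯 F θ hP g₀ os k).ne3.b (c' F) j (sel j V)))
    (hβw : ∀ (F : T4Family) (θ : Stage13HParams F 2) (hP : θ.Provisos₁₃CoPH F 2), (θ.ZhUnity F 2 ∧ θ.SlotsNondegenerate₁₃ F 2) → θ.Admissible F 2 →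
      ∃ γ₀ b b' : ℝ, 0 < γ₀ ∧ 0 < b ∧ DagBinding.BetaBoundsInInterval (datumOfRecord₁₃CoPH F 2 θ hP).C.toB12 γ₀ b b')
    (hζm : ∀ (F : T4Family) (θ : Stage13HParams F 2), θ.Provisos₁₃CoPH F 2 → ((θ.ZhUnity F 2 ∧ θ.SlotsNondegenerate₁₃ F 2) ∧ θ.ppSel = ppSelLiveOfRecord F 2 θ.ν θ.τ9 (EOfRecord₁₃ F 2 θ.toStage13Params) (wOfRecord₉ F 2 θ.toStage9Params)) → θ.Admissible F 2 →
      ZetaMeasurable F 2 θ.ζ)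
    (h20 : ∀ (F : T4Family) (θ : Stage13HParams F 2) (hP : θ.Provisos₁₃CoPH F 2), ((θ.ZhUnity F 2 ∧ θ.SlotsNondegenerate₁₃ F 2) ∧ θ.ppSel = ppSelLiveOfRecord F 2 θ.ν θ.τ9 (EOfRecord₁₃ F 2 θ.toStage13Params) (wOfRecord₉ F 2 θ.toStage9Params)) → θ.Admissible F 2 →
      ∀ (g₀ : ℕ → ℝ) (os : List (ULoop F)),
        ∃ W : ℕ → ℝ, RelWeightBound 1 (classSet₁₃ θ K₀ g₀) (weightA₁₃ θ hP K₀ g₀ os) (weightB₁₃ θ hP K₀ g₀ os) (badClass₁₃ θ K₀ g₀ (jc F θ hP g₀ os)) W)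
    (h21 : ∀ (F : T4Family) (θ : Stage13HParams F 2) (hP : θ.Provisos₁₃CoPH F 2), ((θ.ZhUnity F 2 ∧ θ.SlotsNondegenerate₁₃ F 2) ∧ θ.ppSel = ppSelLiveOfRecord F 2 θ.ν θ.τ9 (EOfRecord₁₃ F 2 θ.toStage13Params) (wOfRecord₉ F 2 θ.toStage9Params)) → θ.Admissible F 2 →
      ∀ (g₀ : ℕ → ℝ) (os : List (ULoop F)),
        ∃ Wsh : ℕ → ℝ, ShellWeightBound 1 (classSet₁₃ θ K₀ g₀) (weightA₁₃ θ hP K₀ g₀ os) (weightB₁₃ θ hP K₀ g₀ os) (sh F θ hP g₀ os).1 (sh F θ hP g₀ os).2 Wsh)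
    (hlinkBareV : ∀ (F : T4Family) (θ : Stage13HParams F 2) (hP : θ.Provisos₁₃CoPH F 2), ((θ.ZhUnity F 2 ∧ θ.SlotsNondegenerate₁₃ F 2) ∧ θ.ppSel = ppSelLiveOfRecord F 2 θ.ν θ.τ9 (EOfRecord₁₃ F 2 θ.toStage13Params) (wOfRecord₉ F 2 θ.toStage9Params)) → θ.Admissible F 2 →
      ∀ (γ gIR b : ℝ) (g₀ : ℕ → ℝ), (datumOfRecord₁₃CoPH F 2 θ hP).Tuned γ gIR g₀ → γ ≤ θ.γ → γ ^ 2 ≤ Real.exp (-1) → 0 < b →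
      (∀ K m, 0 ≤ m → m < K → b ≤ (datumOfRecord₁₃CoPH F 2 θ hP).βfun m (prefixOf (runFlow (datumOfRecord₁₃CoPH F 2 θ hP) g₀ K) m)) →
      ∀ (os : List (ULoop F)) (k : ℕ),
      let S : SpineCarriers := crOfRecord₁₃VAt K₀ (jc F θ hP g₀ os) sh F θ hP g₀ os
      let R : RateCarriers 2 := rateCarriersOfRecord₁₃CoPH 𝔯 F θ hP g₀ os k
      let D : Datum F 2 := datumOfRecord₁₃CoPH F 2 θ hP
      letI := S.dec
      ∃ (_ : DecidableEq R.u3.C.Dom) (F' : Type) (ι' X' : Type) (_ : MeasurableSpace ι')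
        (L : LedgerDataSync R.u3.C F' ι' S.ι) (Rd : Readings ι' X') (bsel : (ℕ → ℝ) → ℝ) (EB : Functional R.u3.C R.u3.C.BgB)
        (g : ℕ → ℕ → ℝ)
        (uA : ℕ → ι' → R.u3.C.BgA) (uB : ℕ → ι' → R.u3.C.BgB)
        (Koff : ℕ) (cells : (K j : ℕ) → R.u3.C.Dom → Finset (Site (F.P (Koff + K)) j))
        (θ : ℝ)
        (rd : ι' → (B7Prop1Explicit.Site 4 → Fin 4 → (Matrix (Fin 2) (Fin 2) ℂ)ˣ)),
        (∀ K i, i ≤ K → g K i = runFlow D g₀ K i) ∧ (∀ K i, K < i → g K i = gIR) ∧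
        EB = (fun s => R.u3.EB (bsel s) s) ∧
        (∀ (Sz : ℕ → ℝ → S.ι → ℕ → ℝ) (E₀ : ℝ) (m : ℕ) (a : ℝ) (Cw Λg : ℝ),
          (∀ K t, |t| ≤ S.l₀ → ∀ τ ∈ S.T K \ S.Bad K t, ∀ v ∈ Rd.dom, ∀ j ≤ K,
            |∑ X ∈ L.fac K t τ with R.u3.C.scale X = j,
                (Real.log (Real.exp (EB (fun i => g (K + 1) (i + 1)) (uB K v) X
                    - EB (fun i => g (K + 1) (i + 1)) L.oneB X))
                  - Real.log (Real.exp (R.u3.EA (g K) (uA K v) X - R.u3.EA (g K) L.oneA X)))| ≤ Sz K t τ j) →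
          0 ≤ E₀ → 0 < a → a < 1 →
          (∀ K t, |t| ≤ S.l₀ → ∀ τ ∈ S.T K \ S.Bad K t, ∀ j ≤ K,
            Sz K t τ j ≤ S.vol * (E₀ * ((K : ℝ) + 1) ^ m * a ^ (K - j))) →
          (∀ K, Multiplicity (L.All K) R.u3.C.scale (fun X => Real.exp (-(R.u3.κ * R.u3.C.d X))) Cw S.vol Λg K) →
          (∀ K t, |t| ≤ S.l₀ → ∀ τ ∈ S.T K \ S.Bad K t,
            WindowMultiplicity (L.facO K t τ) L.scO L.wO Cw S.vol Λg (jlogOf L.Cl K) K) →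
          1 ≤ Λg → L.θ' ≤ Λg →
          LedgerAtSync { L with S := Sz, E₀ := E₀, m := m, a := a, Cw := Cw, Λg := Λg } S.l₀ S.vol S.T S.Bad
            (fun K t τ => S.A K t τ - S.shA K t τ) (fun K t τ => S.B K t τ - S.shB K t τ) Rd R.u3.EA EB R.u3.κ g uA uB
            R.u3.ω R.u3.ρ R.u3.θ (θ ^ ((3 : ℝ) * β - 2))) ∧
        (∀ K t, |t| ≤ S.l₀ → ∀ τ ∈ S.T K \ S.Bad K t,
          WindowMultiplicity (L.facO K t τ) L.scO L.wO L.Cw S.vol L.Λg (jlogOf L.Cl K) K) ∧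
        0 ≤ L.Cw ∧ 1 ≤ L.Λg ∧ L.θ' ≤ L.Λg ∧
        (∀ K, ∀ X ∈ L.All K,
          (cells K (R.u3.C.scale X + Koff) X).Nonempty ∧ TFaceConnected (cells K (R.u3.C.scale X + Koff) X)) ∧
        (∀ K j, Set.InjOn (cells K j) ↑((L.All K).filter fun X => R.u3.C.scale X + Koff = j)) ∧
        (∀ K, ∀ X ∈ L.All K, torusTreeLen (cells K (R.u3.C.scale X + Koff) X) ≤ R.u3.C.d X) ∧
        0 < θ ∧ θ ^ 6 = ((R.ne3.L : ℝ))⁻¹ ∧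
        (∀ v ∈ Rd.dom, rd v ∈ R.ne3.dom) ∧
        (∀ k, ∀ v ∈ Rd.dom, Rd.act k v = minAct 4 (sfClass 4 R.ne3.L R.ne3.Nper R.ne3.ε) R.ne3.L R.ne3.Nper k (rd v)) ∧
        (R.ne3.Nper : ℝ) ^ 4 ≤ Rd.vol ∧
        (∀ s ∈ Window γ, 0 < bsel s ∧ bsel s ≤ γ))
    (htarget : ∀ (F : T4Family) (θ : Stage13HParams F 2) (hP : θ.Provisos₁₃CoPH F 2), ((θ.ZhUnity F 2 ∧ θ.SlotsNondegenerate₁₃ F 2) ∧ ¬ θ.ppSel = ppSelLiveOfRecord F 2 θ.ν θ.τ9 (EOfRecord₁₃ F 2 θ.toStage13Params) (wOfRecord₉ F 2 θ.toStage9Params)) → θ.Admissible F 2 →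
        ForSmallCouplings (datumOfRecord₁₃CoPH F 2 θ hP) fun g₀ => ∀ os : List (ULoop F),
          (RatesHolderAt (datumOfRecord₁₃CoPH F 2 θ hP) (rateCarriersOfRecord₁₃CoPH 𝔯 F θ hP g₀ os (ksel F θ hP g₀ os)) β ∧
              ReadOutAt (datumOfRecord₁₃CoPH F 2 θ hP) (rateCarriersOfRecord₁₃CoPH 𝔯 F θ hP g₀ os (ksel F θ hP g₀ os)).u3 ∧
              (0 ≤ (rateCarriersOfRecord₁₃CoPH 𝔯 F θ hP g₀ os (ksel F θ hP g₀ os)).u3.ρ ∧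
                (rateCarriersOfRecord₁₃CoPH 𝔯 F θ hP g₀ os (ksel F θ hP g₀ os)).u3.ρ < 1)) →
            ∃ δ : ℕ → ℝ, Target ((F.side : ℝ) ^ 4) 1 δ (fun K => T4GenFunBounds.schemeZ ((datumOfRecord₁₃CoPH F 2 θ hP).scheme g₀) os (K₀ + K))) :
    SpineGivenEndpointR13SepCoPHV := by
  have hρ : ∀ (F : T4Family) (θ : Stage13HParams F 2), θ.Provisos₁₃CoPH F 2 → (θ.ZhUnity F 2 ∧ θ.SlotsNondegenerate₁₃ F 2) → θ.Admissible F 2 →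
      0 ≤ (ℓ F θ).ρ ∧ (ℓ F θ).ρ < 1 := fun F θ hP hG hθ => ⟨(hs F θ hP hG hθ).ρ_nonneg, (hs F θ hP hG hθ).ρ_lt_one⟩
  exact fun F θ h v hG hθ _ _ =>
    hybridNE7Under_of_forSmallCouplings_stringwise (Node00.datumOfRecord₁₃SepCoPHV F 2 θ h v)
      (show ForSmallCouplings (Node00.datumOfRecord₁₃SepCoPHV F 2 θ h v) (fun g₀ => StringwiseHybridNE7 ((Node00.datumOfRecord₁₃SepCoPHV F 2 θ h v).scheme g₀)) from
        bodyBFree₁₃CoPH_of_split (fun F (θ : Stage13HParams F 2) => (θ.ZhUnity F 2 ∧ θ.SlotsNondegenerate₁₃ F 2)) (fun F (θ : Stage13HParams F 2) => θ.ppSel = ppSelLiveOfRecord F 2 θ.ν θ.τ9 (EOfRecord₁₃ F 2 θ.toStage13Params) (wOfRecord₉ F 2 θ.toStage9Params))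
          (bodyBFree₁₃CoPH_of_v5pins_bareLedgerReadingV_kernelFaces_at_crOfRecord₁₃VAt_cut K₀ jc sh β 𝔯 ℓ ℓ₃ g B c'
          (fun F (θ : Stage13HParams F 2) => (θ.ZhUnity F 2 ∧ θ.SlotsNondegenerate₁₃ F 2) ∧ θ.ppSel = ppSelLiveOfRecord F 2 θ.ν θ.τ9 (EOfRecord₁₃ F 2 θ.toStage13Params) (wOfRecord₉ F 2 θ.toStage9Params))
          ksel hpin1 hpin2 hpinL hpin (fun F hF => h16 F (hF.elim fun θ h => ⟨θ, h.1, h.2.1.1, h.2.2⟩)) (fun F θ hP hRg hθ => hs F θ hP hRg.1 hθ) (fun F θ hP hRg hθ => hκ F θ hP hRg.1 hθ)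
          (fun F θ hP hRg hθ => hcr F θ hP hRg.1 hθ) (fun F θ hP hRg hθ => hκ₀ F θ hP hRg.1 hθ) (fun μ ν F θ hP hRg hθ => hK μ ν F θ hP hRg.1 hθ) (fun F θ hP hRg hθ => h18 F θ hP hRg.1 hθ)
          (fun F θ hP hRg hθ => h22 F θ hP hRg.1 hθ) hβ23 hβ1 hmatch hend hradii hclass hH3 hsel3
          (fun F θ hP hRg hθ => hβw F θ hP hRg.1 hθ) (fun _ _ _ hRg _ => ⟨_, hRg.2⟩) hζm h20 h21 hlinkBareV)
          (bodyBFree₁₃CoPH_of_kernels_pin_bFree (crOneTerm₁₃ K₀) 𝔯 ksel (fun {F} (θ : Stage13HParams F 2) => ((θ.ZhUnity F 2 ∧ θ.SlotsNondegenerate₁₃ F 2) ∧ ¬ θ.ppSel = ppSelLiveOfRecord F 2 θ.ν θ.τ9 (EOfRecord₁₃ F 2 θ.toStage13Params) (wOfRecord₉ F 2 θ.toStage9Params))) ℓ β hpin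
            (fun F θ hP hRg hθ => ForSmallCouplings.of_forall fun g₀ os => by
              refine ⟨?_, ?_, ?_⟩
              · exact n14At_rateCarriersOfRecord₁₃CoPH_of_pinned 𝔯 hpin1 F θ hP g₀ os (ksel F θ hP g₀ os)
              · obtain ⟨b, aS, ν, μ, α, β', c35, p, hb, haS, h⟩ := hpin2
                rw [h F θ hP g₀ os]
                exact n15At_fullGSizedObjects_family hb haS ν μ α β' c35 p F
              · show N16HolderAt (rateCarriersOfRecord₁₃CoPH 𝔯 F θ hP g₀ os (ksel F θ hP g₀ os)).ne3 β
                rw [rateCarriers_ne3_of_pinnedLoose hpinL F θ hP g₀ os (ksel F θ hP g₀ os)]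
                exact h16 F ⟨θ, hP, hRg.1, hθ⟩)
            (fun F θ hP hRg hθ => hs F θ hP hRg.1 hθ) (fun F θ hP hRg hθ => hκ F θ hP hRg.1 hθ) (fun F θ hP hRg hθ => hcr F θ hP hRg.1 hθ)
            (fun F θ hP hRg hθ => hρ F θ hP hRg.1 hθ) (h20_shape_crOneTerm₁₃ K₀) (h21_shape_crOneTerm₁₃ K₀)
            (fun F θ hP hRg hθ => (htarget F θ hP hRg hθ).mono fun g₀ hg os hPr =>
              (core_crOneTerm₁₃_iff_target K₀ θ hP g₀ os).2 (hg os hPr))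
            (fun _ θ hP _ _ => ForSmallCouplings.of_forall fun g₀ os => extraction_crOneTerm₁₃ K₀ θ hP g₀ os)
            (fun F θ hP hRg hθ => hK 0 1 F θ hP hRg.1 hθ) (fun F θ hP hRg hθ => h18 F θ hP hRg.1 hθ)
            (fun F θ hP hRg hθ => h22 F θ hP hRg.1 hθ))
          F θ h.toCore hG hθ) _

end Summit.QuantumFields.YangMills.Theorems.BalabanUVNodesN27SpineRecord
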